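import Summits.ResolutionOfSingularities.ResolutionOfSingularities.Theorems.FrobeniusClosingSteerEtaleWindowLift
import Summits.ResolutionOfSingularities.ResolutionOfSingularities.Theorems.FrobeniusClosingSteerQuadraticTransformLevelLift
import Summits.ResolutionOfSingularities.ResolutionOfSingularities.Theorems.FrobeniusClosingSteerNoSatelliteStep
import Mathlib.Algebra.CharP.Algebra
import HarnessLib

/-!
# [OURS · L0 W4.1] K3-d: the WINDOW BASE CHANGE — no satellite step at constant cleaned order `2e ≥ 4` WITHOUT residual rationality
# (chain W4.1 `FrobeniusClosingSteer`, crux stmt-ResolutionOfSingularities-16345; K3 route (R1) of record, res-L0-w41-plan-1 RULINGs 250(a)/258/280(a);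
# target `L/res-L0-w41-stub-2/K3/K3_target_signature.lean` ddf2b8c09338c95c `K3Target.nonRationalWindow_free`; `--supports … --as helper`)

HONEST FRAMING. OURS kernel (HIRONAKA-L librarian res-D-lib-1 gen 8). For ONE window `S₀ ⊂ S₁ ⊂ S₂ ⊂ S₃ ⊆ L` (`char L = 2`) of quadratic transforms of
regular local rings of dimension `c ≥ 2` with perfect `κ(S₀)`, excellent `S₁`, laws `f_{i+1} x_i^{2e} = f_i − g_i²` (`e ≥ 2`) and an isolated `2`-radicand
germ of `f₁`, the second step is NOT a satellite step: `(x₀) = (x₁)` in `S₂` — with NO residual-rationality hypothesis. PROOF = base change + descent: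
K3-a (`EtaleLift.exists_rational_window_lift`, res-D-lib-1) lifts the window to `S′₀ ≤ S′₁ ≤ S′₂ ≤ S′₃ ⊆ L′` along unramified faithfully flat local maps
`φᵢ` with `S′₀ ≤ S′₁ ≤ S′₂` residually RATIONAL; K3-b (`QuadraticTransformLift.isQuadraticTransform_of_levelLift` / `span_image_maximalIdeal_of_levelLift`,
res-D-pv-040) lifts the quadratic transforms and the exceptional parameters; K3-c (inside `LevelLift`, res-D-pv-040's `IsolatedEtaleLift`) lifts isolatedness;
the laws are pushed through `φᵢ`; res-L0-w41-stub-2's LEMMA S `NoSatelliteStep.span_excParam_eq_of_rational` applies UPSTAIRS; and `(φ₁ x₀) = (φ₂ x₁)` in `S′₂`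
DESCENDS to `S₂` by `φ₂⁻¹(I S′₂) = I`.
* `law_lift` — transport of one law along the level maps;
* **`span_excParam_eq_of_window`** — (LS) without `hrat₀`, `hrat₁`;
* **`nonRationalWindow_free (c e) (hc : 2 ≤ c) (he : 2 ≤ e)`** — the `hK3` binder of `NoSatelliteStep.noTangentialStepPerfect_of_rational` = lead-1's word
  `NoTangentialStepNonRationalTwo c (2e)` (r49–r57 `hNRW` at `c = 4`), stated by its body (the word is a `def` of the skeleton, not of the tree);
* **`noTangentialStepPerfect_two`** — `NoTangentialStep.NoTangentialStepPerfect 2 c (2e)` for all `c ≥ 2`, `e ≥ 2` (hNT4 = `c = 4`).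
Nothing here is a statement of H. Hironaka's manuscript [Hironaka2017]. AI-written; AI review is weaker than expert review. [cite: Cutkosky2014, §2.1]
-/

set_option linter.dupNamespace false

noncomputable section

namespace Summit.ResolutionOfSingularities.ResolutionOfSingularities.Theorems.SwitchingDichotomy.EtaleLift

open IsLocalRing Polynomial Literature.AlgebraicGeometry.Resolution
open Summit.ResolutionOfSingularities.ResolutionOfSingularities.Theorems.SwitchingDichotomy.SigmaTopLegality
open Summit.ResolutionOfSingularities.ResolutionOfSingularities.Theorems.SwitchingDichotomy.QuadraticTransformLift
open Summit.ResolutionOfSingularities.ResolutionOfSingularities.Theorems.SwitchingDichotomy.NoTangentialStep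

/-- **Transport of one law** `f₁ x₀^d = f₀ − g₀²` (read in `L`) along level maps `φ_A : A → A′`, `φ_B : B → B′` commuting with `A ≤ B`, `A′ ≤ B′`.
[folklore] -/
theorem law_lift {L L' : Type} [Field L] [Field L'] {A B : Subring L} {A' B' : Subring L'} (hle : A ≤ B)
    (φA : A →+* A') (φB : B →+* B') (hcomm : ∀ s : A, ((φB (Subring.inclusion hle s) : B') : L') = ((φA s : A') : L'))
    (f₀ g₀ : A) (f₁ x₀ : B) (d : ℕ) (hlaw : ((f₁ : B) : L) * ((x₀ : B) : L) ^ d = ((f₀ : A) : L) - ((g₀ : A) : L) ^ 2) :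
    ((φB f₁ : B') : L') * ((φB x₀ : B') : L') ^ d = ((φA f₀ : A') : L') - ((φA g₀ : A') : L') ^ 2 := by
  have h1 : f₁ * x₀ ^ d = Subring.inclusion hle f₀ - (Subring.inclusion hle g₀) ^ 2 := by
    apply Subtype.ext
    simp only [Subring.coe_mul, SubmonoidClass.coe_pow, AddSubgroupClass.coe_sub, Subring.coe_inclusion]
    exact hlaw
  have h2 := congrArg (fun z : B' => (z : L')) (congrArg φB h1)
  simp only [map_mul, map_pow, map_sub, Subring.coe_mul, SubmonoidClass.coe_pow, AddSubgroupClass.coe_sub, hcomm] at h2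
  exact h2

/-- **(LS) WITHOUT residual rationality.** For one window `S₀ ⊂ S₁ ⊂ S₂ ⊂ S₃ ⊆ L` (`char L = 2`) of quadratic transforms of regular local rings of
dimension `c ≥ 2`, exceptional parameters `x₀, x₁, x₂`, laws `f_{i+1} x_i^{2e} = f_i − g_i²` (`e ≥ 2`), `κ(S₀)` perfect, `S₁` excellent and
`RadicandRing S₁ 2 f₁` with an isolated singularity: `(x₀) = (x₁)` in `S₂`. Base change (K3-a/b/c) + LEMMA S upstairs + faithfully flat descent.
[cite: Cutkosky2014, §2.1] -/
theorem span_excParam_eq_of_window {L : Type} [Field L] [CharP L 2] (c e : ℕ) (hc : 2 ≤ c) (he : 2 ≤ e)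
    {S₀ S₁ S₂ S₃ : Subring L} [IsLocalRing S₀] [IsLocalRing S₁] [IsLocalRing S₂] [IsLocalRing S₃]
    (h₀₁ : S₀ ≤ S₁) (h₁₂ : S₁ ≤ S₂) (h₂₃ : S₂ ≤ S₃)
    (hreg₀ : IsRegularLocalRing S₀) (hreg₁ : IsRegularLocalRing S₁) (hreg₂ : IsRegularLocalRing S₂) (hreg₃ : IsRegularLocalRing S₃)
    (hdim₀ : ringKrullDim S₀ = c) (hdim₁ : ringKrullDim S₁ = c) (hdim₂ : ringKrullDim S₂ = c) (hdim₃ : ringKrullDim S₃ = c)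
    (hqt₀ : IsQuadraticTransform S₀ S₁) (hqt₁ : IsQuadraticTransform S₁ S₂) (hqt₂ : IsQuadraticTransform S₂ S₃)
    (f₀ g₀ : S₀) (f₁ g₁ : S₁) (f₂ g₂ : S₂) (f₃ : S₃) (x₀ : S₁) (x₁ : S₂) (x₂ : S₃)
    (hx₀ : Ideal.span ((fun y : S₀ => (⟨(y : L), h₀₁ y.2⟩ : S₁)) '' (maximalIdeal S₀ : Set S₀)) = Ideal.span {x₀})
    (hx₁ : Ideal.span ((fun y : S₁ => (⟨(y : L), h₁₂ y.2⟩ : S₂)) '' (maximalIdeal S₁ : Set S₁)) = Ideal.span {x₁})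
    (hx₂ : Ideal.span ((fun y : S₂ => (⟨(y : L), h₂₃ y.2⟩ : S₃)) '' (maximalIdeal S₂ : Set S₂)) = Ideal.span {x₂})
    (hlaw₀ : ((f₁ : S₁) : L) * ((x₀ : S₁) : L) ^ (2 * e) = ((f₀ : S₀) : L) - ((g₀ : S₀) : L) ^ 2)
    (hlaw₁ : ((f₂ : S₂) : L) * ((x₁ : S₂) : L) ^ (2 * e) = ((f₁ : S₁) : L) - ((g₁ : S₁) : L) ^ 2)
    (hlaw₂ : ((f₃ : S₃) : L) * ((x₂ : S₃) : L) ^ (2 * e) = ((f₂ : S₂) : L) - ((g₂ : S₂) : L) ^ 2)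
    (hperf₀ : PerfectField (ResidueField S₀)) (hexc₁ : IsExcellentRing S₁)
    (hiso₁ : HasIsolatedSingularity (RadicandRing S₁ 2 f₁)) :
    Ideal.span {(⟨((x₀ : S₁) : L), h₁₂ x₀.2⟩ : S₂)} = Ideal.span {x₁} := by
  classical
  haveI := hperf₀
  -- ### K3-a: the rational window lift
  obtain ⟨L', _instL', S₀', S₁', S₂', S₃', hl₀, hl₁, hl₂, hl₃, θ, P, φ₀, φ₁, φ₂, φ₃, h₀₁', h₁₂', h₂₃', -, -,
      hL₀, hL₁, hL₂, hL₃, hsq₀₁, hsq₁₂, hsq₂₃, hd₀₁', hd₁₂', hd₂₃', hRR₁, hRR₂⟩ :=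
    exists_rational_window_lift hqt₀ hqt₁ hqt₂ hreg₀ hreg₁ hreg₂ hreg₃ hdim₀ hdim₁ hdim₂ hdim₃
  haveI := hl₀; haveI := hl₁; haveI := hl₂; haveI := hl₃
  -- `char L′ = 2` along the injective `S₀ → S′₀ ⊆ L′`
  haveI : CharP L' 2 :=
    charP_of_injective_ringHom (f := S₀'.subtype.comp φ₀)
      (Subtype.val_injective.comp (injective_of_levelLift hL₀)) 2
  -- ### K3-b: quadratic transforms and exceptional parameters upstairs
  have hqt₀' : IsQuadraticTransform S₀' S₁' := isQuadraticTransform_of_levelLift hqt₀ h₀₁ h₀₁' hL₀ hL₁ hsq₀₁ hd₀₁'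
  have hqt₁' : IsQuadraticTransform S₁' S₂' := isQuadraticTransform_of_levelLift hqt₁ h₁₂ h₁₂' hL₁ hL₂ hsq₁₂ hd₁₂'
  have hqt₂' : IsQuadraticTransform S₂' S₃' := isQuadraticTransform_of_levelLift hqt₂ h₂₃ h₂₃' hL₂ hL₃ hsq₂₃ hd₂₃'
  have hx₀' := span_image_maximalIdeal_of_levelLift h₀₁ h₀₁' φ₁ hL₀ hsq₀₁ x₀ hx₀
  have hx₁' := span_image_maximalIdeal_of_levelLift h₁₂ h₁₂' φ₂ hL₁ hsq₁₂ x₁ hx₁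
  have hx₂' := span_image_maximalIdeal_of_levelLift h₂₃ h₂₃' φ₃ hL₂ hsq₂₃ x₂ hx₂
  -- ### the laws upstairs
  have hlaw₀' := law_lift h₀₁ φ₀ φ₁ hsq₀₁ f₀ g₀ f₁ x₀ (2 * e) hlaw₀
  have hlaw₁' := law_lift h₁₂ φ₁ φ₂ hsq₁₂ f₁ g₁ f₂ x₁ (2 * e) hlaw₁
  have hlaw₂' := law_lift h₂₃ φ₂ φ₃ hsq₂₃ f₂ g₂ f₃ x₂ (2 * e) hlaw₂
  -- ### the level transfers
  obtain ⟨-, -, -, -, -, hreg₀', hdim₀', -, hperf₀', -⟩ := hL₀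
  obtain ⟨-, -, -, -, -, hreg₁', hdim₁', hexc₁', -, hiso₁'⟩ := hL₁
  obtain ⟨-, -, hff₂, -, -, hreg₂', hdim₂', -⟩ := hL₂
  -- ### LEMMA S upstairs (the lifted window is residually rational at both lower steps)
  have key := NoSatelliteStep.span_excParam_eq_of_rational c e hc he h₀₁' h₁₂' h₂₃'
    (hreg₀' hreg₀) (hreg₁' hreg₁) (hreg₂' hreg₂) (hdim₀'.trans hdim₀) (hdim₁'.trans hdim₁) (hdim₂'.trans hdim₂)
    hqt₀' hqt₁' hqt₂' (φ₀ f₀) (φ₀ g₀) (φ₁ f₁) (φ₁ g₁) (φ₂ f₂) (φ₂ g₂) (φ₃ f₃) (φ₁ x₀) (φ₂ x₁) (φ₃ x₂)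
    hx₀' hx₁' hx₂' hlaw₀' hlaw₁' hlaw₂' (hperf₀' hperf₀) (hexc₁' hexc₁) (hiso₁' f₁ hiso₁) hRR₁ hRR₂
  -- ### descent along `φ₂`
  have ha : φ₂ (⟨((x₀ : S₁) : L), h₁₂ x₀.2⟩ : S₂) = (⟨((φ₁ x₀ : S₁') : L'), h₁₂' (φ₁ x₀).2⟩ : S₂') :=
    Subtype.ext (hsq₁₂ x₀)
  calc Ideal.span {(⟨((x₀ : S₁) : L), h₁₂ x₀.2⟩ : S₂)}
      = ((Ideal.span {(⟨((x₀ : S₁) : L), h₁₂ x₀.2⟩ : S₂)}).map φ₂).comap φ₂ := (hff₂ _).symm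
    _ = ((Ideal.span {x₁}).map φ₂).comap φ₂ := by
        rw [Ideal.map_span, Ideal.map_span, Set.image_singleton, Set.image_singleton, ha, key]
    _ = Ideal.span {x₁} := hff₂ _

/-- **K3 TARGET `nonRationalWindow_free` = the `hK3` binder of `NoSatelliteStep.noTangentialStepPerfect_of_rational` = lead-1's T-line word
`NoTangentialStepNonRationalTwo c (2e)` (hNRW at `c = 4`), proved for every `c ≥ 2`, `e ≥ 2`.** The non-rationality disjunct is not even used:
`span_excParam_eq_of_window` holds at every window. [cite: Cutkosky2014, §2.1] -/
theorem nonRationalWindow_free (c e : ℕ) (hc : 2 ≤ c) (he : 2 ≤ e) :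
    ∀ (L : Type) [Field L] [CharP L 2] (S : ℕ → Subring L) [∀ m, IsLocalRing (S m)]
      (hle : ∀ m, S m ≤ S (m + 1)) (f g : ∀ m, S m) (x : ∀ m, S (m + 1)),
      (∀ m, IsRegularLocalRing (S m)) → (∀ m, IsExcellentRing (S m)) → (∀ m, ringKrullDim (S m) = c) →
      (∀ m, IsQuadraticTransform (S m) (S (m + 1))) →
      (∀ m, Ideal.span ((fun y : S m => (⟨(y : L), hle m y.2⟩ : S (m + 1))) '' (maximalIdeal (S m) : Set (S m)))
          = Ideal.span {x m}) →
      (∀ m, ((f (m + 1) : S (m + 1)) : L) * ((x m : S (m + 1)) : L) ^ (2 * e) =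
          ((f m : S m) : L) - ((g m : S m) : L) ^ 2) →
      (∀ m, PerfectField (IsLocalRing.ResidueField (S m))) →
      (∀ m, HasIsolatedSingularity (RadicandRing (S m) 2 (f m))) →
      ∀ m, ((¬ ∀ z : S (m + 1), ∃ s : S m, z - ⟨(s : L), hle m s.2⟩ ∈ maximalIdeal (S (m + 1))) ∨
            (¬ ∀ z : S (m + 2), ∃ s : S (m + 1), z - ⟨(s : L), hle (m + 1) s.2⟩ ∈ maximalIdeal (S (m + 2)))) →
        Ideal.span {(⟨((x m : S (m + 1)) : L), hle (m + 1) (x m).2⟩ : S (m + 2))} = Ideal.span {x (m + 1)} := by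
  intro L _ _ S _ hle f g x hreg hexc hdim hqt hx hlaw hperf hiso m _
  exact span_excParam_eq_of_window c e hc he (hle m) (hle (m + 1)) (hle (m + 2))
    (hreg m) (hreg (m + 1)) (hreg (m + 2)) (hreg (m + 3)) (hdim m) (hdim (m + 1)) (hdim (m + 2)) (hdim (m + 3))
    (hqt m) (hqt (m + 1)) (hqt (m + 2)) (f m) (g m) (f (m + 1)) (g (m + 1)) (f (m + 2)) (g (m + 2)) (f (m + 3))
    (x m) (x (m + 1)) (x (m + 2)) (hx m) (hx (m + 1)) (hx (m + 2)) (hlaw m) (hlaw (m + 1)) (hlaw (m + 2))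
    (hperf m) (hexc (m + 1)) (hiso (m + 1))

/-- **`NoTangentialStepPerfect 2 c (2e)` for every `c ≥ 2`, `e ≥ 2`** (hNT4 is `c = 4`): res-L0-w41-stub-2's glue `NoSatelliteStep.noTangentialStepPerfect_of_rational`
fed with `nonRationalWindow_free`. [cite: Cutkosky2014, §2.1] -/
theorem noTangentialStepPerfect_two (c e : ℕ) (hc : 2 ≤ c) (he : 2 ≤ e) : NoTangentialStepPerfect 2 c (2 * e) :=
  NoSatelliteStep.noTangentialStepPerfect_of_rational c e hc he (nonRationalWindow_free c e hc he)

end Summit.ResolutionOfSingularities.ResolutionOfSingularities.Theorems.SwitchingDichotomy.EtaleLift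

end
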